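import Summits.QuantumFields.YangMills.Theorems.UnitScaleTiltProp7DivRecoveryPatchAlphaRows
import Summits.QuantumFields.YangMills.Theorems.UnitScaleTiltProp7BoxLocalResidualMember
import Summits.QuantumFields.YangMills.Theorems.UnitScaleTiltProp7BoxLocalPotentialCutoffH1
import HarnessLib

/-!
# Prop. 7 on T³ — lane II [I-9]: ONE PATCH OF THE MEMBER — potentials, α-rows, source and `H¹` rows IN BUDGET CURRENCY, BY NAME

Route `UnitScaleTilt`, crux `MinimiserStabilityRegPr` (stmt-QuantumFields-19200), E′ growth side, lane II «divergence recovery at the curved regular member».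
The per-patch half of the member geometry file (`hPatch` of ✓`Prop7DivRecoveryPatchesToRows.hRows_of_core_and_patches`) that is now CLOSED by name:
w4-19200 g11's `Prop7BoxLocalResidualMember.boxLocalResidual_member` (the chart-local Coulomb potential `φ`, source `κs`, transverse remainder `r` of a
box patch, 13 conjuncts) ▸ ✓`Prop7DivRecoveryPatchAlphaRows.patch_alpha_rows` (the α-rows read through the patch cutoffs, in the currency `(L^s, e)`) ▸
w5-20520 g11's ✓`Prop7BoxLocalPotentialCutoffH1.cutoffH1_member` (the interior `H¹` row of the cut-off remainder `ZE r`) ▸ ✓`currency_h10`.  Output, for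
one patch read in a chart `(c, z, R)` with the two plaquette windows displayed (discharged at the record radius by ✓`Prop7DivRecoveryMemberWindows.member_windows_of_le`):
`∃ φ κs r φ_Z m` with the pass-through rows (S1a) (S1b) (D) (0) (consumed by px9 g7's (a′) `h7h8_member` and the (B6) commutator rows), and
`hloc_c`, `hDφ_c`, `Gφ ≤ N_T`, `ρ ≤ N_T`, `Φ ≤ 576L^{2s}N_T`, `ρ ≤ 1944Cc·L^{2s}Cu + 20155392A²L^{4s}e²N_T`, `‖Z κs‖² ≤ K`,
`H(ZE r) ≤ (24 + 432A² + 108)·(Cu_W + e²Φ + K + L^{−2s}ρ)` with `K := 13824A²L^{2s}e²ρ` — i.e. `hPatch`'s rows Φ∕ρ∕K∕Hρ before ✓`patch_budget_v2`.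

HONEST SCOPE.  Composition by name; nothing of (REC)∕hN06∕the crux is proved here; YM₃ on T³ is rung R3 — NOT d = 4, NOT infinite volume, NOT a mass gap, NOT Clay.
[cite: Balaban1985BackgroundPropagators, (3.19)-(3.26) pp.393-395, (3.100) p.413]
-/

noncomputable section

open scoped InnerProductSpace Matrix.Norms.L2Operator BigOperators

namespace Summit.QuantumFields.YangMills.Theorems.Prop7DivRecoveryPatchAlphaMember

open Literature.MathematicalPhysics.QuantumFieldTheory.Balaban1983to89
open Literature.MathematicalPhysics.QuantumFieldTheory.Balaban1983to89.T3ContinuumYM3Torus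
open B11Eq103H1Complex (SiteL2K BondL2K)
open B10Eq27TorusAxialLog (transl unitsField toUField)
open B4Eq19LatticeOperators (Zd box unitVec)
open B7Eq78Linearization (conjR)
open B7Prop1Explicit (axialFn)
open B9TorusCalculus (torusT)
open B9Eq39Adjoint (curl)
open T3SectALandauChart (eta eta_pos)
open Summit.QuantumFields.YangMills.Theorems.Prop7SectET3Transport (periodsT3)
open Summit.QuantumFields.YangMills.Theorems.Prop7SectET3HilbertLetters (W₂ frobEquiv toL2 toL2S DL2 DstarL2 covLapSite)
open Summit.QuantumFields.YangMills.Theorems.Prop7BoxLocalResidualMember (boxLocalResidual_member)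
open Summit.QuantumFields.YangMills.Theorems.Prop7BoxLocalPotentialCutoffH1 (cutoffH1_member)
open Summit.QuantumFields.YangMills.Theorems.Prop7DivRecoveryPatchAlphaRows (patch_alpha_rows)
open Summit.QuantumFields.YangMills.Theorems.Prop7DivRecoveryCutoffReadings (eta_mul_level)
open Summit.QuantumFields.YangMills.Theorems.Prop7DivRecoveryAssemblyBudgetW4 (currency_h10)

variable (F : T3Family) (n K : ℕ) (c₀ : ℝ) [hc : Fact (0 < c₀)]

/-- ★★★ **[I-9] ONE PATCH OF THE MEMBER, α-ROWS + SOURCE + `H¹` ROW, IN BUDGET CURRENCY.**  See the module docstring.  Inputs: the chart data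
`(c, z, R)` with `0 ≤ R`, `1 ≤ R`, `2R+1 ≤ N₀`, `(R:ℝ) ≤ 4·L^s·L^{K−n}`, chart injective on the box; the pull-back `V` with plaquettes `α ≤ A·e·η²` and the two
windows; the one-form `y`; w4 part 3's curl reading `hC`; the patch cutoffs `Z`∕`ZE` (px11 (Z1)(Z2)) with supports in the chart (px9 (Z-box)) and the package
Lipschitz row; the energy bond set `T`. [cite: Balaban1985BackgroundPropagators, (3.19)-(3.26) pp.393-395, (3.100) p.413] -/
theorem patch_alpha_member (s : ℕ) (W : GaugeField (F.P K) 0 (Matrix.specialUnitaryGroup (Fin 2) ℂ))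
    (c : Site (F.P K) 0) {z : Zd (F.P K).d} {R : ℤ} (hR : 0 ≤ R) (hR1 : 1 ≤ R) (hRN : 2 * R + 1 ≤ ((F.P K).sitesPerDir 0 : ℤ))
    (hRf : (R : ℝ) ≤ 4 * (F.L : ℝ) ^ s * (F.L : ℝ) ^ (K - n)) (hinj : Set.InjOn (transl c) ↑(box z R))
    (V : Zd (F.P K).d → Fin (F.P K).d → (Matrix (Fin 2) (Fin 2) ℂ)ˣ) (hV : ∀ w μ, V w μ = unitsField (toUField W) ⟨transl c w, μ⟩)
    {α A e : ℝ} (hα : 0 ≤ α) (hαe : α ≤ A * e * eta F n K ^ 2)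
    (hP : B8Lemma1NonAbelian.PlaqSmall V (fun i => z i - R) (fun i => z i + R) α)
    (hw : 64 * ((F.P K).d : ℝ) ^ 3 * 2 * R ^ 3 * (2 * R + 1) * α ^ 2 ≤ 1)
    (hw4 : 832 * ((F.P K).d : ℝ) ^ 3 * (2 * R + 1) ^ 2 * R ^ 2 * α ^ 2 ≤ 1)
    (y : BondL2K ℂ 3 (periodsT3 F K) c₀ W₂)
    {Cc Cu : ℝ} (hCc : 0 ≤ Cc) (hCu : 0 ≤ Cu)
    (hC : c₀ * ∑ w ∈ box z R, ∑ μ, ∑ ν, (if w + unitVec μ + unitVec ν ∈ box z R then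
              ∑ j : Fin 2, ∑ k : Fin 2, ‖((toL2 F K c₀).symm y ⟨transl c w, μ⟩
                + conjR (V w μ) ((toL2 F K c₀).symm y ⟨transl c (w + unitVec μ), ν⟩)
                - conjR (V w ν) ((toL2 F K c₀).symm y ⟨transl c (w + unitVec ν), μ⟩)
                - (toL2 F K c₀).symm y ⟨transl c w, ν⟩) j k‖ ^ 2 else 0)
          ≤ Cc * ((F.L : ℝ) ^ (K - n))⁻¹ ^ 2 * Cu)
    (Z : SiteL2K ℂ 3 (periodsT3 F K) c₀ W₂ →ₗ[ℂ] SiteL2K ℂ 3 (periodsT3 F K) c₀ W₂) (ζ : Site (F.P K) 0 → ℝ)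
    (hZ : ∀ φ x, (toL2S F K c₀).symm (Z φ) x = ζ x • (toL2S F K c₀).symm φ x) (h01 : ∀ x, 0 ≤ ζ x ∧ ζ x ≤ 1)
    (hζ : ∀ x, ζ x ≠ 0 → ∃ w ∈ box z (R - 1), transl c w = x)
    (hζδ : ∀ (x : Site (F.P K) 0) (μ : Fin (F.P K).d), |ζ (x.shift μ) - ζ x| ≤ 3 / 2 / ((F.L : ℝ) ^ s * (F.L : ℝ) ^ (K - n)))
    (ZE : BondL2K ℂ 3 (periodsT3 F K) c₀ W₂ →ₗ[ℂ] BondL2K ℂ 3 (periodsT3 F K) c₀ W₂)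
    (hZE : ∀ f b, (toL2 F K c₀).symm (ZE f) b = ζ b.src • (toL2 F K c₀).symm f b)
    (hξ : ∀ b : PBond (F.P K) 0, ζ b.src ≠ 0 → ∃ w ∈ box z R, transl c w = b.src ∧ w + unitVec b.dir ∈ box z R)
    (T : Finset (PBond (F.P K) 0))
    (hT : ∀ w ∈ box z R, ∀ μ, w + unitVec μ ∈ box z R → (⟨transl c w, μ⟩ : PBond (F.P K) 0) ∈ T) :
    ∃ (φ κs : SiteL2K ℂ 3 (periodsT3 F K) c₀ W₂) (r : BondL2K ℂ 3 (periodsT3 F K) c₀ W₂)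
      (φZ : Zd (F.P K).d → Matrix (Fin 2) (Fin 2) ℂ) (m : Matrix (Fin 2) (Fin 2) ℂ),
      -- pass-through: (S1a) (S1b) (D) (0)
      (∀ x, (∀ w ∈ box z R, transl c w ≠ x) → (toL2S F K c₀).symm φ x = 0) ∧
      (∀ w ∈ box z R, (toL2S F K c₀).symm φ (transl c w) = (eta F n K) • φZ w) ∧
      (∀ w ∈ box z R, ∀ μ, w + unitVec μ ∈ box z R →
          (toL2 F K c₀).symm (DL2 F n K c₀ W φ) ⟨transl c w, μ⟩ = conjR (V w μ) (φZ (w + unitVec μ)) - φZ w) ∧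
      (∑ w ∈ box z R, conjR (axialFn V (fun i => z i - R) w) (φZ w) = 0) ∧
      -- the source letter (for those who read it)
      (∀ w ∈ box z (R - 1), (toL2S F K c₀).symm κs (transl c w) = (eta F n K)⁻¹ • conjR (axialFn V (fun i => z i - R) w)⁻¹ m) ∧
      -- α-rows in budget currency
      Z (DstarL2 F n K c₀ W y) = Z (covLapSite F n K c₀ W φ) + Z κs ∧
      ZE (DL2 F n K c₀ W φ) = ZE y - ZE r ∧
      c₀ * ∑ w ∈ box z R, ∑ μ, (if w + unitVec μ ∈ box z R then
          ∑ j : Fin 2, ∑ k : Fin 2, ‖(conjR (V w μ) (φZ (w + unitVec μ)) - φZ w) j k‖ ^ 2 else 0)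
        ≤ c₀ * ∑ b ∈ T, ‖(frobEquiv.symm ((toL2 F K c₀).symm y b) : W₂)‖ ^ 2 ∧
      ‖r‖ ^ 2 ≤ c₀ * ∑ b ∈ T, ‖(frobEquiv.symm ((toL2 F K c₀).symm y b) : W₂)‖ ^ 2 ∧
      ‖φ‖ ^ 2 ≤ 576 * ((F.L : ℝ) ^ s) ^ 2 * (c₀ * ∑ b ∈ T, ‖(frobEquiv.symm ((toL2 F K c₀).symm y b) : W₂)‖ ^ 2) ∧
      ‖r‖ ^ 2 ≤ 1944 * Cc * ((F.L : ℝ) ^ s) ^ 2 * Cu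
        + 20155392 * A ^ 2 * ((F.L : ℝ) ^ s) ^ 4 * e ^ 2 * (c₀ * ∑ b ∈ T, ‖(frobEquiv.symm ((toL2 F K c₀).symm y b) : W₂)‖ ^ 2) ∧
      ‖Z κs‖ ^ 2 ≤ 13824 * A ^ 2 * ((F.L : ℝ) ^ s) ^ 2 * e ^ 2 * ‖r‖ ^ 2 ∧
      -- the interior `H¹` row of the cut-off remainder, in budget currency
      c₀ * ((F.L : ℝ) ^ (K - n)) ^ 2 * (∑ x : Site (F.P K) 0, ∑ μ : Fin (F.P K).d, ∑ ν' : Fin (F.P K).d,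
          (if μ < ν' then ∑ j : Fin 2, ∑ k : Fin 2,
            ‖(curl (torusT (F.P K) 0) (fun κ x => unitsField (toUField W) ⟨x, κ⟩) (fun κ x => (toL2 F K c₀).symm (ZE r) ⟨x, κ⟩) μ ν' x) j k‖ ^ 2 else 0))
        + ‖DstarL2 F n K c₀ W (ZE r)‖ ^ 2
        ≤ (24 + 432 * A ^ 2 + 48 * (3 / 2) ^ 2) *
          (c₀ * ((F.L : ℝ) ^ (K - n)) ^ 2 * (∑ w ∈ box z R, ∑ μ : Fin (F.P K).d, ∑ ν' : Fin (F.P K).d,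
              (if μ < ν' then ∑ j : Fin 2, ∑ k : Fin 2,
                ‖(curl (torusT (F.P K) 0) (fun κ x => unitsField (toUField W) ⟨x, κ⟩) (fun κ x => (toL2 F K c₀).symm y ⟨x, κ⟩) μ ν' (transl c w)) j k‖ ^ 2
              else 0))
            + e ^ 2 * ‖φ‖ ^ 2 + 13824 * A ^ 2 * ((F.L : ℝ) ^ s) ^ 2 * e ^ 2 * ‖r‖ ^ 2 + ((F.L : ℝ) ^ s)⁻¹ ^ 2 * ‖r‖ ^ 2) := by
  obtain ⟨φ, κs, r, φZ, m, hS1a, hS1b, hS2a, hS2b, hD, hloc, hL1, h1, h2, h3, -, h4, h0⟩ :=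
    boxLocalResidual_member F n K c₀ W c hR hRN V hV hα hP hw hw4 y
  obtain ⟨hlocZ, hDφ, hGN, hρN, hΦ, hρ, hK, hKl⟩ := patch_alpha_rows F K c₀ n s W c z R hR1 hRf hinj V hα hαe y r φ κs φZ m
    hS2b hD hloc hL1 h1 h2 h3 h4 hCc hCu hC Z ζ hZ h01 hζ ZE hZE hξ T hT
  have hζ1 : ∀ x, |ζ x| ≤ 1 := fun x => abs_le.mpr ⟨by linarith [(h01 x).1], (h01 x).2⟩
  have hζs : ∀ x, (∀ w ∈ box z (R - 1), transl c w ≠ x) → ζ x = 0 := fun x hx => by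
    by_contra h
    obtain ⟨w, hw', hwx⟩ := hζ x h
    exact hx w hw' hwx
  have hH := cutoffH1_member F n K c₀ W c hRN V hV hα hP y φ κs r φZ m hS1a hS1b hS2a hS2b hD hloc hL1 ζ hζ1 hζδ hζs
    (ZE r) (hZE r)
  have hd : (F.P K).d = 3 := T3Family.P_d F K
  have hℓη : eta F n K * (F.L : ℝ) ^ (K - n) = 1 := eta_mul_level F K n
  have hL0 : 0 < F.L := by have := F.hL.2; omega
  have hℓ : 0 < (F.L : ℝ) ^ (K - n) := pow_pos (by exact_mod_cast hL0) _
  have hR₀ : 0 < (F.L : ℝ) ^ s := pow_pos (by exact_mod_cast hL0) _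
  have hδ : 0 ≤ 3 / 2 / ((F.L : ℝ) ^ s * (F.L : ℝ) ^ (K - n)) := by positivity
  have hδC : 3 / 2 / ((F.L : ℝ) ^ s * (F.L : ℝ) ^ (K - n)) ≤ 3 / 2 * ((F.L : ℝ) ^ s * (F.L : ℝ) ^ (K - n))⁻¹ :=
    le_of_eq (div_eq_mul_inv _ _)
  have hK0 : 0 ≤ 13824 * A ^ 2 * ((F.L : ℝ) ^ s) ^ 2 * e ^ 2 * ‖r‖ ^ 2 := by positivity
  have hCuW : 0 ≤ c₀ * ((F.L : ℝ) ^ (K - n)) ^ 2 * (∑ w ∈ box z R, ∑ μ : Fin (F.P K).d, ∑ ν' : Fin (F.P K).d,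
      (if μ < ν' then ∑ j : Fin 2, ∑ k : Fin 2,
        ‖(curl (torusT (F.P K) 0) (fun κ x => unitsField (toUField W) ⟨x, κ⟩) (fun κ x => (toL2 F K c₀).symm y ⟨x, κ⟩) μ ν' (transl c w)) j k‖ ^ 2
      else 0)) := by
    refine mul_nonneg (mul_nonneg hc.out.le (sq_nonneg _)) (Finset.sum_nonneg fun _ _ => Finset.sum_nonneg fun _ _ =>
      Finset.sum_nonneg fun _ _ => ?_)
    split_ifs
    · exact Finset.sum_nonneg fun _ _ => Finset.sum_nonneg fun _ _ => sq_nonneg _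
    · exact le_rfl
  exact ⟨φ, κs, r, φZ, m, hS1a, hS1b, hD, h0, hL1, hlocZ, hDφ, hGN, hρN, hΦ, hρ, hK,
    currency_h10 (d := (F.P K).d) hd hℓη hℓ hR₀ hα hαe hδ hδC (sq_nonneg ‖φ‖) (sq_nonneg ‖r‖) hCuW hK0 hKl hH⟩

end Summit.QuantumFields.YangMills.Theorems.Prop7DivRecoveryPatchAlphaMember

end
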